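import Summits.QuantumFields.QCD.Theorems.QuarksAsStableActionStableActionBridgeStubTorusDenominatorsSpectral
import Summits.QuantumFields.QCD.Theorems.HeatSlicedQuarksRobustYangMillsHandoverTransferFormsEmbed
import Summits.QuantumFields.QCD.Theorems.HeatSlicedQuarksRobustYangMillsHandoverTransferSpectralDecay
import HarnessLib

/-!
# Spectral representation of both torus denominators of lattice QCD, with the level-one clause
(crux `HeatSlicedQuarks.RobustYangMillsHandover`, item stmt-QuantumFields-8892, line `pin-the-infimum`;
registered stub `stub_torusDenominators_spectral_levelOne`, wave 3 / U1)

The landed E3 of crux 9737 (`stub_torusDenominators_spectral`) realises Lüscher's transfer matrix of lattice QCD as the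
compact self-adjoint integral operator `A` on `L²(SU(3)^{E₃} × Finset(modes), Haar ⊗ count; ℂ)` with the Hermitian kernel
`k((U,s),(U',s')) = (R(U) B(U,U') R(U'))_{s s'}` (`R = √T̂_F` pointwise, `B(U,U') = ∫ K_β(U,U'^g) Γ(G_g) dg` the
Gauss-averaged Wilson bond kernel), writes BOTH Berezin torus denominators as (super)traces `Σ σᵢ λᵢ^N`, `Σ λᵢ^N` over a
parity-adapted Hilbert basis of eigenvectors `A bᵢ = λᵢ bᵢ`, and pins the TOP eigenvalue to `qcdTransferLevel N_f N β m 0`.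
Its conclusion hides the eigenbasis behind an `∃`, so this file RE-RUNS the same assembly (same `obtain` chain of landed
sub-goals) and inserts ONE new conjunct, the easy half of min–max for the SECOND level (Reed–Simon XIII.1):

  `∀ i ≠ i₀, λᵢ ≤ qcdTransferLevel N_f N β m 1 = inf_{Φ ∈ core} sup {R(Ψ) : Ψ ∈ core, 𝔫(Ψ,Ψ) ≠ 0, 𝔫(Φ,Ψ) = 0}`.

Proof of the new conjunct (`StubTorusDenominatorsLevelOne.lam_le_qcdTransferLevel_one`).  If `λᵢ ≤ 0` use `0 ≤ λ₁`.
Otherwise both `b_{i₀}` and `bᵢ` are eigenvectors with non-zero eigenvalue, hence (the wave-function construction of the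
landed C1 `StubEigenRayleigh`) embedded CORE waves: `b_{i₀} = RΨ₀`, `bᵢ = RΨ₁` a.e., `Ψ₀, Ψ₁ ∈ transferCore`.  Given a
constraint wave `Φ ∈ core`, embed it as `g = RΦ ∈ L²`; some `(a, c) ≠ 0` solves `a⟪g, b_{i₀}⟫ + c⟪g, bᵢ⟫ = 0`, and the
trial vector `f = a b_{i₀} + c bᵢ = R(aΨ₀ + cΨ₁)` a.e. is the embedding of a core wave `Ψ`.  Faithfulness of the
embedding (`TransferFormsEmbed.inner_embed_eq_fermionWeightForm`) gives `𝔫(Φ,Ψ) = ⟪g,f⟫ = 0` and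
`𝔫(Ψ,Ψ) = ‖f‖² = |a|² + |c|² ≠ 0`; unscalarisation (`StubRayleighLeOfEigenLe.inner_toLp_eq_integral`) and the landed B4
`stub_rayleigh_of_invariant` give `𝔱(Ψ,Ψ) = ⟪f, A f⟫ = λ_{i₀}|a|² + λᵢ|c|² ≥ λᵢ‖f‖²`.  So `R(Ψ) ≥ λᵢ` for an admissible
trial wave of EVERY constraint, i.e. `λᵢ ≤ λ₁`.

Pure theorem file (no definitions, no notation); helpers in the sub-namespace `StubTorusDenominatorsLevelOne`.
[cite: ReedSimonIV1978, Thm XIII.1] [cite: Luscher1977, pp. 283–292] [cite: Smit2023, §6.5 (6.87)]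
[cite: MontvayMunster1994, §4.1 (4.34)] [cite: ReedSimonI1980, Thm. VI.16 and VI.22–23]
-/

noncomputable section

namespace Summit.QuantumFields.QCD.Cruxes.RobustYangMillsHandover.PinTheInfimum

open MeasureTheory Filter Function Matrix
open Literature.MathematicalPhysics.QuantumFieldTheory Literature.MathematicalPhysics.QuantumLattice
open Literature.Probability.LatticeModels
open scoped InnerProductSpace ComplexConjugate BigOperators ENNReal
open Literature.Analysis.OperatorTheory
open Summit.QuantumFields.QCD.Cruxes.StableActionBridge
open Summit.QuantumFields.QCD.Cruxes.StableActionBridge.TwistedTraceTransfer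

namespace StubTorusDenominatorsLevelOne

/-- **Two orthonormal eigenvectors span a plane on which `A` is diagonal**: for `A u = l₀ u`, `A v = l₁ v`, `‖u‖ = ‖v‖ = 1`,
`⟪u, v⟫ = 0` and `f = a u + c v`: `‖f‖² = |a|² + |c|²` and `Re ⟪f, A f⟫ = l₀|a|² + l₁|c|²`. [folklore] -/
theorem eigenCombo_norm_sq_and_re_inner {E : Type*} [NormedAddCommGroup E] [InnerProductSpace ℂ E] (A : E →L[ℂ] E)
    {u v : E} (hu : ‖u‖ = 1) (hv : ‖v‖ = 1) (huv : ⟪u, v⟫_ℂ = 0) {l₀ l₁ : ℝ} (hAu : A u = (l₀ : ℂ) • u)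
    (hAv : A v = (l₁ : ℂ) • v) (a c : ℂ) :
    ‖a • u + c • v‖ ^ 2 = ‖a‖ ^ 2 + ‖c‖ ^ 2 ∧ (⟪a • u + c • v, A (a • u + c • v)⟫_ℂ).re = l₀ * ‖a‖ ^ 2 + l₁ * ‖c‖ ^ 2 := by
  have hvu : ⟪v, u⟫_ℂ = 0 := by rw [← inner_conj_symm, huv, map_zero]
  have huu : ⟪u, u⟫_ℂ = 1 := by rw [inner_self_eq_norm_sq_to_K, hu]; simp
  have hvv : ⟪v, v⟫_ℂ = 1 := by rw [inner_self_eq_norm_sq_to_K, hv]; simp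
  have hAf : A (a • u + c • v) = (a * l₀) • u + (c * l₁) • v := by
    rw [map_add, map_smul, map_smul, hAu, hAv, smul_smul, smul_smul]
  have hff : ⟪a • u + c • v, a • u + c • v⟫_ℂ = ((‖a‖ ^ 2 + ‖c‖ ^ 2 : ℝ) : ℂ) := by
    simp only [inner_add_left, inner_add_right, inner_smul_left, inner_smul_right, huu, hvv, huv, hvu, mul_zero, mul_one,
      add_zero, zero_add]
    push_cast
    linear_combination Complex.mul_conj' a + Complex.mul_conj' c
  have hfAf : ⟪a • u + c • v, A (a • u + c • v)⟫_ℂ = ((l₀ * ‖a‖ ^ 2 + l₁ * ‖c‖ ^ 2 : ℝ) : ℂ) := by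
    rw [hAf]
    simp only [inner_add_left, inner_add_right, inner_smul_left, inner_smul_right, huu, hvv, huv, hvu, mul_zero, mul_one,
      add_zero, zero_add]
    push_cast
    linear_combination (l₀ : ℂ) * Complex.mul_conj' a + (l₁ : ℂ) * Complex.mul_conj' c
  refine ⟨?_, by rw [hfAf, Complex.ofReal_re]⟩
  rw [@norm_sq_eq_re_inner ℂ, hff, RCLike.re_to_complex, Complex.ofReal_re]

variable {Nf S : ℕ} [NeZero S]
  {R : GaugeConfig 3 S (Matrix.specialUnitaryGroup (Fin 3) ℂ) → Matrix (Finset (SliceFermiIdx Nf S)) (Finset (SliceFermiIdx Nf S)) ℂ}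
  {k : GaugeConfig 3 S (Matrix.specialUnitaryGroup (Fin 3) ℂ) × Finset (SliceFermiIdx Nf S) →
    GaugeConfig 3 S (Matrix.specialUnitaryGroup (Fin 3) ℂ) × Finset (SliceFermiIdx Nf S) → ℂ}
  {A : Lp ℂ 2 ((sliceHaar S).prod (Measure.count : Measure (Finset (SliceFermiIdx Nf S)))) →L[ℂ]
    Lp ℂ 2 ((sliceHaar S).prod (Measure.count : Measure (Finset (SliceFermiIdx Nf S))))}

/-- **Eigenvectors with non-zero eigenvalue are embedded core waves** (the wave-function construction of `StubEigenRayleigh`,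
for an abstract bond kernel `B` with jointly continuous entries and left covariance `B(U^h,U') = Γ(G_h) B(U,U')`): if `A` on
`L²(Haar ⊗ count)` is given a.e. by `k = (R B R)_{s s'}` and `A φ = λ φ`, `λ ≠ 0`, then `φ = R Ψ` a.e. for the continuous
gauge-invariant `Ψ(U) = λ⁻¹ ∫ B(U,U') R(U') φ(U',·)`. [cite: Luscher1977, pp. 283–292] -/
theorem exists_core_repr_of_eigen (hRc : Continuous R)
    {B : GaugeConfig 3 S (Matrix.specialUnitaryGroup (Fin 3) ℂ) → GaugeConfig 3 S (Matrix.specialUnitaryGroup (Fin 3) ℂ) →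
      Matrix (Finset (SliceFermiIdx Nf S)) (Finset (SliceFermiIdx Nf S)) ℂ}
    (hBc : ∀ a c, Continuous fun p : GaugeConfig 3 S (Matrix.specialUnitaryGroup (Fin 3) ℂ) ×
      GaugeConfig 3 S (Matrix.specialUnitaryGroup (Fin 3) ℂ) => B p.1 p.2 a c)
    (hBcov : ∀ h U U', B (gaugeTransform h U) U' = fockGaugeAct h * B U U') (hk : ∀ y y', k y y' = (R y.1 * B y.1 y'.1 * R y'.1) y.2 y'.2)
    (hA : ∀ φ : Lp ℂ 2 ((sliceHaar S).prod (Measure.count : Measure (Finset (SliceFermiIdx Nf S)))),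
      (A φ : GaugeConfig 3 S (Matrix.specialUnitaryGroup (Fin 3) ℂ) × Finset (SliceFermiIdx Nf S) → ℂ)
        =ᵐ[(sliceHaar S).prod (Measure.count : Measure (Finset (SliceFermiIdx Nf S)))]
        fun y => ∫ y', k y y' * φ y' ∂((sliceHaar S).prod (Measure.count : Measure (Finset (SliceFermiIdx Nf S)))))
    {φ : Lp ℂ 2 ((sliceHaar S).prod (Measure.count : Measure (Finset (SliceFermiIdx Nf S))))} {lam : ℝ} (hlam : lam ≠ 0)
    (hAφ : A φ = (lam : ℂ) • φ) :
    ∃ Ψ : SliceWave Nf S, Ψ ∈ transferCore Nf S ∧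
      (φ : GaugeConfig 3 S (Matrix.specialUnitaryGroup (Fin 3) ℂ) × Finset (SliceFermiIdx Nf S) → ℂ)
        =ᵐ[(sliceHaar S).prod (Measure.count : Measure (Finset (SliceFermiIdx Nf S)))] fun y => (R y.1 *ᵥ Ψ y.1) y.2 := by
  haveI := Sketch.isProbabilityMeasure_sliceHaar S
  obtain ⟨Ψ, hΨ⟩ : ∃ Ψ : SliceWave Nf S, ∀ U a, Ψ U a = (lam : ℂ)⁻¹ *
      ∫ y', (B U y'.1 * R y'.1) a y'.2 * φ y' ∂((sliceHaar S).prod Measure.count) := ⟨_, fun _ _ => rfl⟩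
  refine ⟨Ψ, ⟨StubEigenRayleigh.continuous_wave hRc hBc φ hΨ, fun h U => StubEigenRayleigh.wave_covariance hRc hBc φ hΨ (hBcov h U)⟩, ?_⟩
  have hlamC : (lam : ℂ) ≠ 0 := Complex.ofReal_ne_zero.mpr hlam
  have hbI : ∀ y : GaugeConfig 3 S (Matrix.specialUnitaryGroup (Fin 3) ℂ) × Finset (SliceFermiIdx Nf S),
      (R y.1 *ᵥ Ψ y.1) y.2 = (lam : ℂ)⁻¹ * ∫ y', k y y' * φ y' ∂((sliceHaar S).prod Measure.count) := by
    rintro ⟨U, s⟩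
    simp only [hk]
    exact StubEigenRayleigh.mulVec_wave hRc hBc φ hΨ U s
  have h1 := hA φ
  rw [hAφ] at h1
  filter_upwards [h1, Lp.coeFn_smul (lam : ℂ) φ] with y hy hy'
  rw [hbI, ← hy, hy', Pi.smul_apply, smul_eq_mul, ← mul_assoc, inv_mul_cancel₀ hlamC, one_mul]

/-- **Both forms through the embedding, for the AVERAGED kernel**: if `A` on `L²(Haar ⊗ count)` is given a.e. by the scalarised
averaged kernel and `f = RΨ` a.e. for a core wave `Ψ`, then `⟪f, A f⟫ = 𝔱(Ψ,Ψ)` (unscalarisation + the landed B4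
`stub_rayleigh_of_invariant`) and `⟪f, f⟫ = 𝔫(Ψ,Ψ)` (`TransferFormsEmbed.inner_embed_eq_fermionWeightForm`).
[cite: Luscher1977, pp. 283–292] [cite: Smit2023, §6.5 (6.87)] -/
theorem inner_apply_eq_transferForm (β : ℝ) (mq : Fin Nf → ℝ) (hm : ∀ f, -1 < mq f) (hRc : Continuous R)
    (hR : ∀ U, (R U)ᴴ = R U ∧ R U * R U = fermionSliceOp U mq)
    (hk : ∀ y y', k y y' = (R y.1 * (Matrix.of fun a c => ∫ g : TorusSite 3 S → (Matrix.specialUnitaryGroup (Fin 3) ℂ),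
          (gaugeSliceKernel β y.1 (gaugeTransform g y'.1) : ℂ) * @fockGaugeAct Nf S _ g a c
            ∂(Measure.pi fun _ => haarProbability (Matrix.specialUnitaryGroup (Fin 3) ℂ))) * R y'.1) y.2 y'.2)
    (hA : ∀ φ : Lp ℂ 2 ((sliceHaar S).prod (Measure.count : Measure (Finset (SliceFermiIdx Nf S)))),
      (A φ : GaugeConfig 3 S (Matrix.specialUnitaryGroup (Fin 3) ℂ) × Finset (SliceFermiIdx Nf S) → ℂ)
        =ᵐ[(sliceHaar S).prod (Measure.count : Measure (Finset (SliceFermiIdx Nf S)))]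
        fun y => ∫ y', k y y' * φ y' ∂((sliceHaar S).prod (Measure.count : Measure (Finset (SliceFermiIdx Nf S)))))
    {Ψ : SliceWave Nf S} (hΨ : Ψ ∈ transferCore Nf S) {f : Lp ℂ 2 ((sliceHaar S).prod (Measure.count : Measure (Finset (SliceFermiIdx Nf S))))}
    (hf : (f : GaugeConfig 3 S (Matrix.specialUnitaryGroup (Fin 3) ℂ) × Finset (SliceFermiIdx Nf S) → ℂ)
      =ᵐ[(sliceHaar S).prod (Measure.count : Measure (Finset (SliceFermiIdx Nf S)))] fun y => (R y.1 *ᵥ Ψ y.1) y.2) :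
    ⟪f, A f⟫_ℂ = transferForm β mq Ψ Ψ ∧ ⟪f, f⟫_ℂ = fermionWeightForm mq Ψ Ψ := by
  haveI := Sketch.isProbabilityMeasure_sliceHaar S
  obtain ⟨h1, -⟩ := stub_rayleigh_of_invariant Nf S β mq hm R hRc hR Ψ hΨ
  have hvs : ∀ s : Finset (SliceFermiIdx Nf S), Continuous fun U : GaugeConfig 3 S (Matrix.specialUnitaryGroup (Fin 3) ℂ) => (R U *ᵥ Ψ U) s :=
    fun s => (continuous_apply s).comp' (hRc.matrix_mulVec hΨ.1)
  have hv : MemLp (fun y : GaugeConfig 3 S (Matrix.specialUnitaryGroup (Fin 3) ℂ) × Finset (SliceFermiIdx Nf S) => (R y.1 *ᵥ Ψ y.1) y.2) 2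
      ((sliceHaar S).prod (Measure.count : Measure (Finset (SliceFermiIdx Nf S)))) := StubRayleighLeOfEigenLe.memLp_two_prod_count hvs
  have hfv : hv.toLp _ = f := Lp.ext (hv.coeFn_toLp.trans hf.symm)
  have h1' : ∫ U, ∫ U', ∑ s, ∑ s', conj ((R U *ᵥ Ψ U) s) * k (U, s) (U', s') * (R U' *ᵥ Ψ U') s' ∂(sliceHaar S) ∂(sliceHaar S) =
      transferForm β mq Ψ Ψ := by
    simp only [hk]
    exact h1
  refine ⟨?_, TransferFormsEmbed.inner_embed_eq_fermionWeightForm Nf S mq (Finset (SliceFermiIdx Nf S)) (Equiv.refl _) R hRc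
    (fun U => (hR U).1) (fun U => (hR U).2) Ψ Ψ hΨ.1 hΨ.1 f f hf hf⟩
  rw [← hfv]
  exact (StubRayleighLeOfEigenLe.inner_toLp_eq_integral hvs hv (StubRayleighLeOfEigenLe.continuous_kernel_sections β hRc hk) hA).trans h1'

/-- **Level-one min–max bound for the eigenvalues of the averaged QCD transfer kernel** (Reed–Simon XIII.1, easy half): for
`β ≥ 0`, `m_f > −1`, any bounded `A` on `L²(Haar ⊗ count)` with the a.e. formula of the scalarised averaged kernel and a Hilbert
basis of eigenvectors `A bᵢ = λᵢ bᵢ`, two distinct indices `i ≠ i₀` with `λᵢ ≤ λ_{i₀}` have `λᵢ ≤ qcdTransferLevel N_f S β m 1`: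
every constraint wave of the level-`1` problem is `𝔫`-orthogonal to a non-zero eigen-combination `a b_{i₀} + c bᵢ = R(aΨ₀ + cΨ₁)`,
a core trial wave of Rayleigh quotient `(λ_{i₀}|a|² + λᵢ|c|²)/(|a|² + |c|²) ≥ λᵢ`. [cite: ReedSimonIV1978, Thm XIII.1] -/
theorem lam_le_qcdTransferLevel_one (β : ℝ) (mq : Fin Nf → ℝ) (hβ : 0 ≤ β) (hm : ∀ f, -1 < mq f) (hRc : Continuous R)
    (hR : ∀ U, (R U)ᴴ = R U ∧ R U * R U = fermionSliceOp U mq)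
    (hk : ∀ y y', k y y' = (R y.1 * (Matrix.of fun a c => ∫ g : TorusSite 3 S → (Matrix.specialUnitaryGroup (Fin 3) ℂ),
          (gaugeSliceKernel β y.1 (gaugeTransform g y'.1) : ℂ) * @fockGaugeAct Nf S _ g a c
            ∂(Measure.pi fun _ => haarProbability (Matrix.specialUnitaryGroup (Fin 3) ℂ))) * R y'.1) y.2 y'.2)
    (hA : ∀ φ : Lp ℂ 2 ((sliceHaar S).prod (Measure.count : Measure (Finset (SliceFermiIdx Nf S)))),
      (A φ : GaugeConfig 3 S (Matrix.specialUnitaryGroup (Fin 3) ℂ) × Finset (SliceFermiIdx Nf S) → ℂ)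
        =ᵐ[(sliceHaar S).prod (Measure.count : Measure (Finset (SliceFermiIdx Nf S)))]
        fun y => ∫ y', k y y' * φ y' ∂((sliceHaar S).prod (Measure.count : Measure (Finset (SliceFermiIdx Nf S)))))
    {ι : Type} (b : HilbertBasis ι ℂ (Lp ℂ 2 ((sliceHaar S).prod (Measure.count : Measure (Finset (SliceFermiIdx Nf S))))))
    {lam : ι → ℝ} (hb : ∀ i, A (b i) = (lam i : ℂ) • (b i : Lp ℂ 2 ((sliceHaar S).prod (Measure.count : Measure (Finset (SliceFermiIdx Nf S))))))
    {i₀ i : ι} (hne : i ≠ i₀) (hle : lam i ≤ lam i₀) : lam i ≤ qcdTransferLevel Nf S β mq 1 := by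
  rcases le_or_gt (lam i) 0 with h0 | h0
  · exact h0.trans (Sketch.TransferLevelOrder.qcdTransferLevel_nonneg hβ hm 1)
  haveI := Sketch.isProbabilityMeasure_sliceHaar S
  have hBc : ∀ a c, Continuous fun p : GaugeConfig 3 S (Matrix.specialUnitaryGroup (Fin 3) ℂ) × GaugeConfig 3 S (Matrix.specialUnitaryGroup (Fin 3) ℂ) =>
      (Matrix.of fun a c => ∫ g : TorusSite 3 S → (Matrix.specialUnitaryGroup (Fin 3) ℂ),
        (gaugeSliceKernel β p.1 (gaugeTransform g p.2) : ℂ) * @fockGaugeAct Nf S _ g a c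
          ∂(Measure.pi fun _ => haarProbability (Matrix.specialUnitaryGroup (Fin 3) ℂ))) a c := fun a c => by
    simpa only [Matrix.of_apply] using stub_bondKernel_continuous Nf S β a c
  -- core representatives of the two eigenvectors
  obtain ⟨Ψ₀, hΨ₀, hf₀⟩ := exists_core_repr_of_eigen (A := A)
    (B := fun U U' => Matrix.of fun a c => ∫ g : TorusSite 3 S → (Matrix.specialUnitaryGroup (Fin 3) ℂ),
      (gaugeSliceKernel β U (gaugeTransform g U') : ℂ) * @fockGaugeAct Nf S _ g a c ∂(Measure.pi fun _ => haarProbability (Matrix.specialUnitaryGroup (Fin 3) ℂ)))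
    hRc hBc (fun h U U' => StubEigenRayleigh.bondKernel_gaugeTransform_left β h U U') hk hA (h0.trans_le hle).ne' (hb i₀)
  obtain ⟨Ψ₁, hΨ₁, hf₁⟩ := exists_core_repr_of_eigen (A := A)
    (B := fun U U' => Matrix.of fun a c => ∫ g : TorusSite 3 S → (Matrix.specialUnitaryGroup (Fin 3) ℂ),
      (gaugeSliceKernel β U (gaugeTransform g U') : ℂ) * @fockGaugeAct Nf S _ g a c ∂(Measure.pi fun _ => haarProbability (Matrix.specialUnitaryGroup (Fin 3) ℂ)))
    hRc hBc (fun h U U' => StubEigenRayleigh.bondKernel_gaugeTransform_left β h U U') hk hA h0.ne' (hb i)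
  -- below every constrained supremum of the level-one problem
  unfold qcdTransferLevel
  refine le_csInf (Sketch.TransferLevelOrder.qcdTransferLevel_set_nonempty β mq 1) ?_
  rintro _ ⟨Φ, hΦ, rfl⟩
  have hΦc : Continuous (Φ 0) := (hΦ 0).1
  -- the embedded constraint wave `g = RΦ`
  have hg : MemLp (fun y : GaugeConfig 3 S (Matrix.specialUnitaryGroup (Fin 3) ℂ) × Finset (SliceFermiIdx Nf S) => (R y.1 *ᵥ Φ 0 y.1) y.2) 2
      ((sliceHaar S).prod (Measure.count : Measure (Finset (SliceFermiIdx Nf S)))) :=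
    StubRayleighLeOfEigenLe.memLp_two_prod_count fun s => (continuous_apply s).comp' (hRc.matrix_mulVec hΦc)
  -- a non-zero eigen-combination `f = a b_{i₀} + c bᵢ` orthogonal to `g`, and its core wave `Ψ = aΨ₀ + cΨ₁`
  obtain ⟨a, c, hac, horth⟩ : ∃ a c : ℂ, (a ≠ 0 ∨ c ≠ 0) ∧ a * ⟪hg.toLp _, b i₀⟫_ℂ + c * ⟪hg.toLp _, b i⟫_ℂ = 0 := by
    by_cases hp : ⟪hg.toLp _, b i₀⟫_ℂ = 0
    · exact ⟨1, 0, Or.inl one_ne_zero, by rw [hp]; ring⟩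
    · exact ⟨⟪hg.toLp _, b i⟫_ℂ, -⟪hg.toLp _, b i₀⟫_ℂ, Or.inr (neg_ne_zero.mpr hp), by ring⟩
  have hΨcore : a • Ψ₀ + c • Ψ₁ ∈ transferCore Nf S :=
    TransferSpectralDecay.add_mem_transferCore (TransferSpectralDecay.smul_mem_transferCore a hΨ₀) (TransferSpectralDecay.smul_mem_transferCore c hΨ₁)
  have hfae : ((a • (b i₀ : Lp ℂ 2 ((sliceHaar S).prod (Measure.count : Measure (Finset (SliceFermiIdx Nf S))))) + c • b i :
        Lp ℂ 2 ((sliceHaar S).prod (Measure.count : Measure (Finset (SliceFermiIdx Nf S))))) :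
          GaugeConfig 3 S (Matrix.specialUnitaryGroup (Fin 3) ℂ) × Finset (SliceFermiIdx Nf S) → ℂ)
      =ᵐ[(sliceHaar S).prod (Measure.count : Measure (Finset (SliceFermiIdx Nf S)))] fun y => (R y.1 *ᵥ (a • Ψ₀ + c • Ψ₁) y.1) y.2 := by
    filter_upwards [Lp.coeFn_add (a • (b i₀ : Lp ℂ 2 ((sliceHaar S).prod (Measure.count : Measure (Finset (SliceFermiIdx Nf S)))))) (c • b i),
      Lp.coeFn_smul a (b i₀ : Lp ℂ 2 ((sliceHaar S).prod (Measure.count : Measure (Finset (SliceFermiIdx Nf S))))),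
      Lp.coeFn_smul c (b i : Lp ℂ 2 ((sliceHaar S).prod (Measure.count : Measure (Finset (SliceFermiIdx Nf S))))), hf₀, hf₁]
      with y hadd ha hc hy₀ hy₁
    rw [hadd, Pi.add_apply, ha, hc, Pi.smul_apply, Pi.smul_apply, hy₀, hy₁, Pi.add_apply, Pi.smul_apply, Pi.smul_apply, Matrix.mulVec_add,
      Matrix.mulVec_smul, Matrix.mulVec_smul, Pi.add_apply, Pi.smul_apply, Pi.smul_apply, smul_eq_mul, smul_eq_mul]
  obtain ⟨hnorm, hre⟩ := eigenCombo_norm_sq_and_re_inner A (b.orthonormal.norm_eq_one i₀) (b.orthonormal.norm_eq_one i)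
    (b.orthonormal.inner_eq_zero (Ne.symm hne)) (hb i₀) (hb i) a c
  have hpos : 0 < ‖a‖ ^ 2 + ‖c‖ ^ 2 := by
    rcases hac with ha | hc
    · exact add_pos_of_pos_of_nonneg (pow_pos (norm_pos_iff.mpr ha) 2) (sq_nonneg _)
    · exact add_pos_of_nonneg_of_pos (sq_nonneg _) (pow_pos (norm_pos_iff.mpr hc) 2)
  -- the two forms of the trial wave, the constraint, and its Rayleigh quotient
  obtain ⟨hT, hN⟩ := inner_apply_eq_transferForm β mq hm hRc hR hk hA hΨcore hfae
  have hN' : fermionWeightForm mq (a • Ψ₀ + c • Ψ₁) (a • Ψ₀ + c • Ψ₁) = ((‖a‖ ^ 2 + ‖c‖ ^ 2 : ℝ) : ℂ) := by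
    rw [← hN, inner_self_eq_norm_sq_to_K, ← hnorm]
    norm_cast
  have hn0 : fermionWeightForm mq (a • Ψ₀ + c • Ψ₁) (a • Ψ₀ + c • Ψ₁) ≠ 0 := by
    rw [hN']
    exact_mod_cast hpos.ne'
  have hconstr : fermionWeightForm mq (Φ 0) (a • Ψ₀ + c • Ψ₁) = 0 := by
    rw [← TransferFormsEmbed.inner_embed_eq_fermionWeightForm Nf S mq (Finset (SliceFermiIdx Nf S)) (Equiv.refl _) R hRc (fun U => (hR U).1)
      (fun U => (hR U).2) (Φ 0) (a • Ψ₀ + c • Ψ₁) hΦc hΨcore.1 (hg.toLp _)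
      (a • (b i₀ : Lp ℂ 2 ((sliceHaar S).prod (Measure.count : Measure (Finset (SliceFermiIdx Nf S))))) + c • b i) hg.coeFn_toLp hfae,
      inner_add_right, inner_smul_right, inner_smul_right]
    exact horth
  have hRay : lam i ≤ transferRayleigh β mq (a • Ψ₀ + c • Ψ₁) := by
    unfold transferRayleigh
    rw [← hT, hN', Complex.ofReal_re, le_div_iff₀ hpos, hre]
    nlinarith [mul_le_mul_of_nonneg_right hle (sq_nonneg ‖a‖)]
  refine hRay.trans (le_csSup (Sketch.TransferLevelOrder.bddAbove_transferRayleigh_image hβ hm (Sketch.TransferLevelOrder.continuous_of_mem_constraint Φ))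
    ⟨a • Ψ₀ + c • Ψ₁, ⟨hΨcore, hn0, fun j => ?_⟩, rfl⟩)
  rw [Subsingleton.elim j 0]
  exact hconstr

end StubTorusDenominatorsLevelOne

open StubTorusDenominatorsLevelOne StubTorusDenominatorsSpectral

/-- U1: E3 of crux 9737 (`stub_torusDenominators_spectral`, verbatim) PLUS the level-one clause: every excited eigenvalue is
bounded by the second min–max level `qcdTransferLevel … 1`.  For `β ≥ 0`, all `m_f > −1` and every torus `(ℤ/N)⁴`, `N ≥ 2`, one
countable family of levels `0 ≤ λᵢ ≤ λ_{i₀} = qcdTransferLevel N_f N β m 0`, `0 < λ_{i₀}`, `λᵢ ≤ qcdTransferLevel N_f N β m 1`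
for `i ≠ i₀`, `Σ λᵢ² < ∞`, with parities `σᵢ = ±1`, represents `ε · Z_W · ∫ ∫dψ̄dψ e^{−ψ̄ D^{AP} ψ} dμ_W = Σᵢ λᵢ^N` and
`ε · Z_W · ∫ ∫dψ̄dψ e^{−ψ̄ D ψ} dμ_W = Σᵢ σᵢ λᵢ^N` (same assembly of the landed E3 sub-goals as `stub_torusDenominators_spectral`,
plus `StubTorusDenominatorsLevelOne.lam_le_qcdTransferLevel_one`). [cite: Luscher1977, pp. 283–292] [cite: MontvayMunster1994, §4.1 (4.34)]
[cite: ReedSimonI1980, Thm. VI.16 and VI.22–23] [cite: ReedSimonIV1978, Thm XIII.1] -/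
theorem stub_torusDenominators_spectral_levelOne :
    ∀ (Nf N : ℕ) [NeZero N], 2 ≤ N → ∀ (β : ℝ) (mq : Fin Nf → ℝ),
    0 ≤ β → (∀ f, -1 < mq f) →
    ∃ (ι : Type) (_ : Countable ι) (lam σ : ι → ℝ) (i₀ : ι),
      (∀ i, 0 ≤ lam i ∧ lam i ≤ lam i₀) ∧ (∀ i, σ i = 1 ∨ σ i = -1) ∧ 0 < lam i₀ ∧
      lam i₀ = qcdTransferLevel Nf N β mq 0 ∧ (∀ i, i ≠ i₀ → lam i ≤ qcdTransferLevel Nf N β mq 1) ∧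
      Summable (fun i => lam i ^ 2) ∧
      HasSum (fun i => (lam i : ℂ) ^ N)
        ((-1 : ℂ) ^ (Fintype.card (FermiIdx Nf N) * (Fintype.card (FermiIdx Nf N) - 1) / 2 + Fintype.card (FermiIdx Nf N)) *
          ((∫ U : GaugeConfig 4 N (Matrix.specialUnitaryGroup (Fin 3) ℂ), Real.exp (-(β * wilsonAction (fundamentalRep (Fin 3)) U))
              ∂(Measure.pi fun _ : Edge 4 N => haarProbability (Matrix.specialUnitaryGroup (Fin 3) ℂ)) : ℝ) : ℂ) *
          ∫ U : GaugeConfig 4 N (Matrix.specialUnitaryGroup (Fin 3) ℂ), fermiIntegral (fermiBoltzmannAP U mq)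
            ∂(wilsonMeasure (d := 4) (L := N) (fundamentalRep (Fin 3)) β)) ∧
      HasSum (fun i => (σ i : ℂ) * (lam i : ℂ) ^ N)
        ((-1 : ℂ) ^ (Fintype.card (FermiIdx Nf N) * (Fintype.card (FermiIdx Nf N) - 1) / 2 + Fintype.card (FermiIdx Nf N)) *
          ((∫ U : GaugeConfig 4 N (Matrix.specialUnitaryGroup (Fin 3) ℂ), Real.exp (-(β * wilsonAction (fundamentalRep (Fin 3)) U))
              ∂(Measure.pi fun _ : Edge 4 N => haarProbability (Matrix.specialUnitaryGroup (Fin 3) ℂ)) : ℝ) : ℂ) *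
          ∫ U : GaugeConfig 4 N (Matrix.specialUnitaryGroup (Fin 3) ℂ), fermiIntegral (fermiBoltzmann U mq)
            ∂(wilsonMeasure (d := 4) (L := N) (fundamentalRep (Fin 3)) β)) := by
  intro Nf N _ hN β mq hβ hm
  -- the spaces
  set X := GaugeConfig 3 N (Matrix.specialUnitaryGroup (Fin 3) ℂ) with hXdef
  set Fι := Finset (SliceFermiIdx Nf N) with hFdef
  set ρ : Measure (X × Fι) := (sliceHaar N).prod (Measure.count : Measure Fι) with hρ
  haveI : SecondCountableTopology (Matrix (Fin 3) (Fin 3) ℂ) := inferInstance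
  haveI : SecondCountableTopology (Matrix.specialUnitaryGroup (Fin 3) ℂ) := Topology.IsEmbedding.subtypeVal.secondCountableTopology
  haveI hprob : IsProbabilityMeasure (sliceHaar (S := N)) := Sketch.isProbabilityMeasure_sliceHaar N
  haveI : IsFiniteMeasure ρ := by rw [hρ]; infer_instance
  haveI : MeasureTheory.IsSeparable ρ := by rw [hρ]; infer_instance
  haveI : Fact ((2 : ℝ≥0∞) ≠ ⊤) := ⟨ENNReal.ofNat_ne_top⟩
  -- B1: the square root
  obtain ⟨R, hRc, hR⟩ := stub_fermionSliceOp_sqrt Nf N mq hm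
  have hR2 : ∀ U, (R U)ᴴ = R U ∧ R U * R U = fermionSliceOp U mq := fun U => ⟨(hR U).1, (hR U).2.1⟩
  -- the scalar kernel and its properties (C6)
  set k : X × Fι → X × Fι → ℂ := fun y y' => (R y.1 * (Matrix.of fun a c => ∫ g : TorusSite 3 N → (Matrix.specialUnitaryGroup (Fin 3) ℂ),
      (gaugeSliceKernel β y.1 (gaugeTransform g y'.1) : ℂ) * @fockGaugeAct Nf N _ g a c
        ∂(Measure.pi fun _ => haarProbability (Matrix.specialUnitaryGroup (Fin 3) ℂ))) * R y'.1) y.2 y'.2 with hk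
  obtain ⟨-, hkm, ⟨C, hkC⟩, hkh, hkpar⟩ := stub_scalarKernel_props Nf N β mq hm R hRc hR k (fun _ _ => rfl)
  -- the operator
  obtain ⟨A, hA, hsa, hcpt, -⟩ := exists_hermitianKernelOp ρ k C hkm hkC hkh
  -- parity
  set w : X × Fι → ℝ := fun y => (-1 : ℝ) ^ y.2.card with hw
  have hwm : Measurable w := by
    refine Measurable.comp (g := fun s : Fι => (-1 : ℝ) ^ s.card) (measurable_of_countable _) measurable_snd
  have hw1 : ∀ y, w y = 1 ∨ w y = -1 := fun y => by
    rcases neg_one_pow_eq_or ℝ y.2.card with h | h <;> simp [hw, h]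
  have hwc : ∀ y, ((w y : ℝ) : ℂ) = (-1 : ℂ) ^ y.2.card := fun y => by simp [hw]
  obtain ⟨F, hF, hFsa, hFF, hFcomm, hFinner⟩ := stub_mulInvolutionOp (X × Fι) ρ w hwm hw1
  have hinter : ∀ x y, k x y * (w y : ℂ) = (w x : ℂ) * k x y := by
    intro x y
    by_cases hxy : (-1 : ℂ) ^ x.2.card = (-1 : ℂ) ^ y.2.card
    · rw [hwc, hwc, hxy, mul_comm]
    · rw [hkpar x y hxy, zero_mul, mul_zero]
  have hAF : A * F = F * A := hFcomm k C hkm hkC hinter A hA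
  -- parity-adapted eigenbasis (C5)
  obtain ⟨ι, b, lam, σ, hb, hFb, hσ⟩ := stub_jointEigenbasis_involution (Lp ℂ 2 ρ) A F hsa hcpt hFsa hFF hAF
  -- countability of the index
  have hinj : Function.Injective (b : ι → Lp ℂ 2 ρ) := b.orthonormal.linearIndependent.injective
  haveI hcnt : Countable ι := by
    have hon : Orthonormal ℂ ((↑) : Set.range (b : ι → Lp ℂ 2 ρ) → Lp ℂ 2 ρ) := (orthonormal_subtype_range hinj).2 b.orthonormal
    haveI := (hon.countable_of_separableSpace (𝕜 := ℂ)).to_subtype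
    have hinj' : Function.Injective (fun i : ι => (⟨b i, i, rfl⟩ : Set.range (b : ι → Lp ℂ 2 ρ))) := fun i j h => hinj (congrArg Subtype.val h)
    exact hinj'.countable
  -- levels in [0, level 0], leastness (D3)
  obtain ⟨hbound, hleast⟩ := stub_levelZero_eq_eigenmax Nf N β mq hβ hm R hRc hR2 k (fun _ _ => rfl) A hsa hA ι b lam hb
  -- Σ λ² < ∞ from the trace formula with F = 1, M = 0 (A2)
  have hone : ∀ i, ∫ y, ((‖(b i : X × Fι → ℂ) y‖ ^ 2 : ℝ) : ℂ) ∂ρ = 1 := fun i => integral_norm_sq_eq_one (b i) (b.orthonormal.norm_eq_one i)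
  have hS2 : Summable fun i => lam i ^ 2 := by
    have h := stub_spectralTraceC (X × Fι) ρ k C hkm hkC hkh A hA ι b lam hb (fun _ => (1 : ℂ)) 1 measurable_const (fun _ => by simp) 0
    have hfun : (fun i => (lam i : ℂ) ^ (0 + 2) * ∫ x, (1 : ℂ) * ((‖(b i : X × Fι → ℂ) x‖ ^ 2 : ℝ) : ℂ) ∂ρ) = fun i => ((lam i ^ 2 : ℝ) : ℂ) := by
      funext i
      have h1 : ∫ x, (1 : ℂ) * ((‖(b i : X × Fι → ℂ) x‖ ^ 2 : ℝ) : ℂ) ∂ρ = 1 := by simp only [one_mul]; exact hone i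
      rw [h1, mul_one, Complex.ofReal_pow]
    rw [hfun] at h
    exact Complex.summable_ofReal.1 h.summable
  -- top index (D2) and the level-one bound (U1)
  set s := qcdTransferLevel Nf N β mq 0 with hs
  have hs0 : 0 < s := Sketch.TransferLevelBounds.qcdTransferLevel_zero_pos hβ hm
  obtain ⟨i₀, hi₀⟩ := stub_exists_top_index ι lam s hs0 hS2 (fun i => (hbound i).2) hleast
  have hlev1 : ∀ i, i ≠ i₀ → lam i ≤ qcdTransferLevel Nf N β mq 1 := fun i hi =>
    lam_le_qcdTransferLevel_one (R := R) (k := k) (A := A) β mq hβ hm hRc hR2 (fun _ _ => rfl) hA b hb hi (hi₀ ▸ (hbound i).2)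
  -- the cyclic integrals: N = M + 2
  obtain ⟨M, rfl⟩ : ∃ M, N = M + 2 := ⟨N - 2, by omega⟩
  have hP : ∀ U, Matrix.diagonal (fun s : Fι => (-1 : ℂ) ^ s.card) * R U = R U * Matrix.diagonal (fun s : Fι => (-1 : ℂ) ^ s.card) :=
    fun U => (hR U).2.2 _ (StubScalarKernelProps.parity_comm_fermionSliceOp U mq)
  obtain ⟨hAP, hPer⟩ := stub_cyclic_scalarise Nf (M + 2) β mq R hRc (fun U => (hR U).2.1) hP
  -- the cyclic integrals over `Y` are diagonal iterates (A1)
  set κ : (X × Fι → ℂ) → X × Fι → ℂ := fun f x => ∫ z, k x z * f z ∂ρ with hκ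
  have hkmeas : Measurable (Function.uncurry k) := hkm.measurable
  have hwb : ∀ y, ‖((w y : ℝ) : ℂ)‖ ≤ 1 := fun y => by
    rcases hw1 y with h | h <;> simp [h]
  have hwmC : Measurable fun y : X × Fι => ((w y : ℝ) : ℂ) := Complex.measurable_ofReal.comp hwm
  have hpeel : ∀ G : X × Fι → ℂ, Measurable G → (∀ y, ‖G y‖ ≤ 1) →
      ∫ V : Fin (M + 2) → X × Fι, G (V 0) * ∏ t, k (V t) (V (t + 1)) ∂(Measure.pi fun _ => ρ) = ∫ x, G x * (κ^[M + 1]) (fun z => k z x) x ∂ρ := by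
    intro G hGm hGb
    have h := stub_cyclicPeelC (X × Fι) ρ k C hkmeas hkC M 0 G (fun _ => (1 : ℂ)) 1 1 hGm measurable_const hGb (fun _ => by simp) ⟨1, by omega⟩ rfl
    have h' : ∫ V : Fin (M + 2) → X × Fι, G (V 0) * 1 * ∏ t, k (V t) (V (t + 1)) ∂(Measure.pi fun _ => ρ) =
        ∫ x, G x * (κ^[0 + 1]) (fun y => (1 : ℂ) * (κ^[M]) (fun z => k z x) y) x ∂ρ := h
    have hl : (fun V : Fin (M + 2) → X × Fι => G (V 0) * 1 * ∏ t, k (V t) (V (t + 1))) = fun V => G (V 0) * ∏ t, k (V t) (V (t + 1)) :=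
      funext fun V => by rw [mul_one]
    rw [hl] at h'
    refine h'.trans (integral_congr_ae (Eventually.of_forall fun x => ?_))
    have e : (fun y => (1 : ℂ) * (κ^[M]) (fun z => k z x) y) = (κ^[M]) (fun z => k z x) := funext fun y => one_mul _
    dsimp only
    rw [e, zero_add, Function.iterate_one, ← Function.iterate_succ_apply' κ M]
  have hpeel1 : ∫ V : Fin (M + 2) → X × Fι, ∏ t, k (V t) (V (t + 1)) ∂(Measure.pi fun _ => ρ) = ∫ x, (κ^[M + 1]) (fun z => k z x) x ∂ρ := by
    simpa only [one_mul] using hpeel (fun _ => (1 : ℂ)) measurable_const (fun _ => by simp)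
  have hpeelw : ∫ V : Fin (M + 2) → X × Fι, (-1 : ℂ) ^ (V 0).2.card * ∏ t, k (V t) (V (t + 1)) ∂(Measure.pi fun _ => ρ) =
      ∫ x, ((w x : ℝ) : ℂ) * (κ^[M + 1]) (fun z => k z x) x ∂ρ := by
    have hl : (fun V : Fin (M + 2) → X × Fι => ((w (V 0) : ℝ) : ℂ) * ∏ t, k (V t) (V (t + 1))) =
        fun V => (-1 : ℂ) ^ (V 0).2.card * ∏ t, k (V t) (V (t + 1)) := funext fun V => by rw [hwc]
    have h := hpeel (fun y => ((w y : ℝ) : ℂ)) hwmC hwb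
    rw [hl] at h
    exact h
  -- trace formulas (A2)
  have htr1 := stub_spectralTraceC (X × Fι) ρ k C hkm hkC hkh A hA ι b lam hb (fun _ => (1 : ℂ)) 1 measurable_const (fun _ => by simp) M
  have htrw := stub_spectralTraceC (X × Fι) ρ k C hkm hkC hkh A hA ι b lam hb (fun y => ((w y : ℝ) : ℂ)) 1 hwmC hwb M
  simp only [one_mul] at htr1
  -- positivity of Z_W and the capstones
  have hZ := wilsonBoltzmann_integral_pos (M + 2) β
  have hcapAP := Sketch.integral_fermiBoltzmannAP_wilsonMeasure_eq_cyclic_trace Nf (M + 2) β mq hm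
  have hcapP := Sketch.integral_fermiBoltzmann_wilsonMeasure_eq_cyclic_supertrace Nf (M + 2) β mq hm
  -- assemble
  refine ⟨ι, hcnt, lam, σ, i₀, fun i => ⟨(hbound i).1, hi₀ ▸ (hbound i).2⟩, hσ, hi₀ ▸ hs0, hi₀, hlev1, hS2, ?_, ?_⟩
  · -- thermal: trace
    rw [hcapAP, sign_cancel _ hZ.ne', hAP]
    have hterm : (fun i => (lam i : ℂ) ^ (M + 2)) = fun i => (lam i : ℂ) ^ (M + 2) * ∫ x, ((‖(b i : X × Fι → ℂ) x‖ ^ 2 : ℝ) : ℂ) ∂ρ :=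
      funext fun i => by rw [hone i, mul_one]
    rw [hterm]
    convert htr1 using 1
  · -- periodic: supertrace
    rw [hcapP, sign_cancel _ hZ.ne', hPer]
    have hterm : (fun i => (σ i : ℂ) * (lam i : ℂ) ^ (M + 2)) =
        fun i => (lam i : ℂ) ^ (M + 2) * ∫ x, ((w x : ℝ) : ℂ) * ((‖(b i : X × Fι → ℂ) x‖ ^ 2 : ℝ) : ℂ) ∂ρ := by
      funext i
      rw [← hFinner (b i), hFb i, inner_smul_right, inner_self_eq_norm_sq_to_K, b.orthonormal.norm_eq_one i]
      push_cast
      ring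
    rw [hterm]
    convert htrw using 1

end Summit.QuantumFields.QCD.Cruxes.RobustYangMillsHandover.PinTheInfimum

end
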